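import Summits.QuantumFields.YangMills.Theorems.UnitScaleTiltCurvGradFlatTensor
import Literature.MathematicalPhysics.QuantumFieldTheory.Balaban1983to89.B4Eq19LatticeInteriorHolder
import HarnessLib

/-!
# Flat-lattice input of the curvature HÖLDER bound: **the interior `½`-HÖLDER estimate for a lattice 2-tensor from its divergence and coboundary, WITHOUT THE
# LOGARITHM** — `‖M(z′) − M(0)‖ ≤ C·(M₀ + R·(M₁ + M₂))·√(|z′|_∞∕R)` for every 2-tensor `M` on `ℤ^d` with values in a real normed space
# (route `UnitScaleTilt`, crux K1 «MinimiserStabilityRegPr» stmt-QuantumFields-19200; (L3′b)-GRAD row (★) «η-scale ½-Hölder modulus of the axial-gauge representative»,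
# piece R3′-flat — ★p1 g25 CHAIR WORD №4 (b) ∕ ★★OWNER RULING №35-B, 2026-08-30)

Cell `ym3-torus` (HUMAN RULING D-0037; rung R3 = SU(2) YM₃ on T³ — NOT d = 4, NOT infinite volume, NOT a mass gap, NOT Clay).  Width seat `ym-ust-19200-w5` (gen 14).
THEOREMS ONLY (0 `def`, 0 `sorry`; default heartbeats except ONE disclosed decl-local `maxHeartbeats 400000 in` on `tensor_holder_le`, cell rule); `--supports stmt-QuantumFields-19200
--as helper`; count-neutral.

WHY.  ★p1 g13's ✓`CurvGradFlatTensor.tensor_norm_sub_le` is the Calderón–Zygmund ENDPOINT (one-step differences, factor `1 + log R`, Lawler Green-kernel road); read at the member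
(`R = η⁻¹ = L^{K−n}`) its logarithm is `(K−n)·log L` — NOT K-uniform (✓`CritCurvGradLog.regPr_curvGrad_lt`: «the logarithm is all that fails»).  The (★) row of (L3′b)-GRAD needs only
HALF a derivative: the `½`-Hölder modulus at scale `R`, which the discrete Campanato road gives WITHOUT a logarithm — lit ✓`B4Eq19LatticeInteriorHolder.exists_interior_holder_const`
(pub-balaban NE9 gen 94): `(−Δ + K⁻²)u = ∂*g`, `|u| ≤ M_u`, `|g| ≤ m` on `Q_{4K}(a)` ⟹ `|u(x′) − u(a)| ≤ C_d(M_u + K·m)√(ρ₀∕K)` for `x′ ∈ Q_{ρ₀}(a)`, `1 ≤ ρ₀ ≤ K` — BOUNDED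
divergence-form data, no modulus, no log.  THIS FILE is the 2-tensor (div–curl) reading of that lemma, in the letters of ✓`CurvGradFlatTensor` (so that ✓`CurvGradAxialFlat` §1–§2's
axial-gauge data `‖M‖ ≤ a`, `‖div₂M‖ ≤ b + O(Ra²)`, `‖d₂M‖ ≤ O(Ra²)` dock VERBATIM): each component of the Hodge identity `div₃(d₂M) + d₁(div₂M) = −ΔM` (lit
✓`LatticeChain.div₃_d₂_add_d₁_div₂`, Fröhlich–Spencer) is ONE lattice divergence `dvg G` with `|G| ≤ M₂ + 2M₁`; the mass term `K⁻²u` of the lit lemma is moved to the data side as the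
divergence of a one-direction box antiderivative (`|G₀| ≤ (8K+1)K⁻²M₀`, so `K·|G₀| ≤ 9M₀`); values in a real normed space `E` by duality (Hahn–Banach, as in ✓`divForm_norm_sub_le`).
WHAT IS PROVED (ns `Summit.QuantumFields.YangMills.Theorems.CurvGradFlat`, no clash with the landed files).
* §1 bookkeeping: `Icc_eq_insert_Icc_sub_one` (integer intervals), `mem_box_zero_iff`, `abs_add_one_le`∕`abs_sub_one_le` (unit steps stay in the big box).
* §2 ★★ `tensor_holder_le` (`d ≥ 1`): `∃ C ≥ 0, ∀ R ≥ 4`, for every `M : ℤ^d → Fin d → Fin d → E` with `‖M‖ ≤ M₀`, `‖div₂M‖ ≤ M₁`, `‖d₂M‖ ≤ M₂` on the sup-box `{|z_k| ≤ 4R}`: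
  `‖M(z′; κ, μ) − M(0; κ, μ)‖ ≤ C·(M₀ + R·(M₁ + M₂))·√(ρ₀∕R)` whenever `1 ≤ ρ₀`, `ρ₀ + 1 ≤ R`, `|z′_k| ≤ ρ₀` — `C = 20·C_d` with `C_d` the lit Hölder constant.
CONSUMER: `UnitScaleTiltCurvGradAxialHolder` (the axial-gauge curved `ℤ^d` twin of ✓`CurvGradAxialFlat.norm_covDeriv_plaqF_le`, Hölder edition), then px19 g12's torus transfer + holonomy ladder
(✓`TorusWrapHolonomies`, ⧗`LadderHolonomyModulus`) ⟹ (★) `‖V(b) − V(b′)‖ ≤ C·ε₀·η·(tdist·η)^{½}` at every `RegPr` member, K-uniform.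
HONEST SCOPE.  [folklore] lattice analysis (a reading of a landed lit lemma); nothing of (★), (G1-1..3), the ten print rows, `hT`, `hGF`, EX or the crux is proved here; the YM mass gap is NOT proved.
References: M. Giaquinta, *Multiple integrals in the calculus of variations* (1983) [Giaquinta1984] Ch. III §1–§2 (Campanato ⇒ Hölder); T. Bałaban, CMP **96** (1984) 223–250
[Balaban1984PropagatorsII] (1.9) p.226; J. Fröhlich, T. Spencer, CMP **83** (1982) §2.3 (lattice Hodge identity).
-/

set_option autoImplicit false

noncomputable section

open Finset
open Literature.Probability.LatticeModels (Site)
open Literature.MathematicalPhysics.QuantumFieldTheory.LatticeForm (e d₁ d₂)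
open Literature.MathematicalPhysics.QuantumFieldTheory.LatticeChain (div₂ div₃ negLap₂ div₃_d₂_add_d₁_div₂)
open Literature.MathematicalPhysics.QuantumFieldTheory.Balaban1983to89.B4Eq19LatticeOperators (Zd unitVec box lop dvg)
open Literature.MathematicalPhysics.QuantumFieldTheory.Balaban1983to89.B4Eq19LatticeInteriorHolder (exists_interior_holder_const)

namespace Summit.QuantumFields.YangMills.Theorems.CurvGradFlat

variable {d : ℕ}

/-! ## §1 Bookkeeping -/

/-- `[a, b] = {b} ∪ [a, b − 1]` for integers `a ≤ b`, `b ∉ [a, b − 1]`. [folklore] -/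
theorem Icc_eq_insert_Icc_sub_one {a b : ℤ} (hab : a ≤ b) : Finset.Icc a b = insert b (Finset.Icc a (b - 1)) := by
  ext t
  simp only [Finset.mem_Icc, Finset.mem_insert]
  omega

/-- `b ∉ [a, b − 1]`. [folklore] -/
theorem not_mem_Icc_sub_one (a b : ℤ) : b ∉ Finset.Icc a (b - 1) := by
  simp only [Finset.mem_Icc]; omega

/-- Membership in the lit box centred at `0`. [folklore] -/
theorem mem_box_zero_iff {y : Zd d} {r : ℤ} : y ∈ box (0 : Zd d) r ↔ ∀ i, |y i| ≤ r := by
  rw [Literature.MathematicalPhysics.QuantumFieldTheory.Balaban1983to89.B4Eq19LatticeOperators.mem_box]; simp only [Pi.zero_apply, sub_zero]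

/-- The unit vectors of the two lattice dictionaries agree. [folklore] -/
theorem e_eq_unitVec (i : Fin d) : (e i : Site d) = unitVec i := rfl

/-- One unit step stays in the next box: `|y_k| ≤ r ⇒ |(y ± e_i)_k| ≤ r + 1`. [folklore] -/
theorem abs_add_unit_le {y : Site d} {r : ℤ} (hy : ∀ k, |y k| ≤ r) (i k : Fin d) : |(y + e i) k| ≤ r + 1 ∧ |(y - e i) k| ≤ r + 1 := by
  have h := hy k
  by_cases hik : k = i
  · subst hik
    simp only [Pi.add_apply, Pi.sub_apply, Pi.single_eq_same]
    constructor
    · exact (abs_add_le _ _).trans (by rw [abs_one]; linarith)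
    · exact (abs_sub _ _).trans (by rw [abs_one]; linarith)
  · simp only [Pi.add_apply, Pi.sub_apply, Pi.single_eq_of_ne hik, add_zero, sub_zero]
    constructor <;> linarith

/-- Updating one coordinate inside `[−r, r]` keeps the sup-box. [folklore] -/
theorem abs_update_le {y : Site d} {r : ℤ} (hy : ∀ k, |y k| ≤ r) (i : Fin d) {t : ℤ} (ht : |t| ≤ r) (k : Fin d) : |Function.update y i t k| ≤ r := by
  by_cases hik : k = i
  · subst hik; rw [Function.update_self]; exact ht
  · rw [Function.update_of_ne hik]; exact hy k

/-! ## §2 ★★ The `½`-Hölder estimate for a 2-tensor from its divergence and coboundary -/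

-- HEARTBEAT rule (cell README): one long assembly (`set` abstractions + duality + the lit Hölder lemma) measured between 100k and 200k; decl-local budget, never file-global.
set_option maxHeartbeats 400000 in
/-- ★★ **INTERIOR `½`-HÖLDER ESTIMATE FOR A LATTICE 2-TENSOR FROM ITS DIVERGENCE AND COBOUNDARY — NO LOGARITHM** (`d ≥ 1`, any real normed space `E`): there is `C ≥ 0` such that for
`R ≥ 4` and every `M : ℤ^d → Fin d → Fin d → E` with, on the sup-box `{|z_k| ≤ 4R}`, `‖M(z; κ, μ)‖ ≤ M₀`, `‖(div₂ M)(z; a)‖ ≤ M₁` and `‖(d₂ M)(z; a, b, c)‖ ≤ M₂` (ALL index values),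
for all `κ μ` and every `z′` with `|z′_k| ≤ ρ₀`, `1 ≤ ρ₀`, `ρ₀ + 1 ≤ R`:  `‖M(z′; κ, μ) − M(0; κ, μ)‖ ≤ C·(M₀ + R·(M₁ + M₂))·√(ρ₀∕R)`.
Each component of `div₃(d₂ M) + d₁(div₂ M) = negLap₂ M` is ONE lattice divergence with bounded data; lit ✓`exists_interior_holder_const` at `K := R − 1` after the mass `K⁻²u` is written as the
divergence of a box antiderivative; `E`-valued by duality. [folklore] [cite: Giaquinta1984, Ch. III §1 Thm 1.2, §2 Thm 2.2; Balaban1984PropagatorsII, (1.9) p.226] -/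
theorem tensor_holder_le {E : Type*} [NormedAddCommGroup E] [NormedSpace ℝ E] (hd : 1 ≤ d) : ∃ C : ℝ, 0 ≤ C ∧ ∀ (R : ℕ), 4 ≤ R →
    ∀ (M : Site d → Fin d → Fin d → E) (M₀ M₁ M₂ : ℝ),
    (∀ z : Site d, (∀ k, |z k| ≤ 4 * (R : ℤ)) → ∀ κ μ, ‖M z κ μ‖ ≤ M₀) →
    (∀ z : Site d, (∀ k, |z k| ≤ 4 * (R : ℤ)) → ∀ a, ‖div₂ M z a‖ ≤ M₁) →
    (∀ z : Site d, (∀ k, |z k| ≤ 4 * (R : ℤ)) → ∀ a b c, ‖d₂ M z a b c‖ ≤ M₂) →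
    ∀ (κ μ : Fin d) (z' : Site d) (ρ₀ : ℕ), 1 ≤ ρ₀ → ρ₀ + 1 ≤ R → (∀ k, |z' k| ≤ (ρ₀ : ℤ)) →
      ‖M z' κ μ - M 0 κ μ‖ ≤ C * (M₀ + R * (M₁ + M₂)) * Real.sqrt ((ρ₀ : ℝ) / R) := by
  obtain ⟨Ch, hCh0, hH⟩ := exists_interior_holder_const d hd
  refine ⟨20 * Ch, by positivity, ?_⟩
  intro R hR M M₀ M₁ M₂ hM hdiv hd₂ κ μ z' ρ₀ hρ₀ hρR hz'
  -- the inner scale `K := R − 1`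
  obtain ⟨K, rfl⟩ : ∃ K, R = K + 1 := ⟨R - 1, by omega⟩
  have hK3 : 3 ≤ K := by omega
  have hK0 : (0 : ℝ) < K := by exact_mod_cast (show 0 < K by omega)
  have hK1 : (1 : ℝ) ≤ K := by exact_mod_cast (show 1 ≤ K by omega)
  have hρK : ρ₀ ≤ K := by omega
  have hRK : ((K + 1 : ℕ) : ℝ) = (K : ℝ) + 1 := by push_cast; ring
  -- nonnegativity of the letters
  have hz0 : ∀ k, |(0 : Site d) k| ≤ 4 * ((K + 1 : ℕ) : ℤ) := fun k => by simp only [Pi.zero_apply, abs_zero]; positivity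
  have hM00 : 0 ≤ M₀ := (norm_nonneg _).trans (hM 0 hz0 κ μ)
  have hM10 : 0 ≤ M₁ := (norm_nonneg _).trans (hdiv 0 hz0 κ)
  have hM20 : 0 ≤ M₂ := by
    have hd0 : 0 < d := hd
    exact (norm_nonneg _).trans (hd₂ 0 hz0 ⟨0, hd0⟩ κ μ)
  -- box bookkeeping: the lit box `box 0 (4K)` sits inside `{|z_k| ≤ 4R}` with one unit step of room
  have hbig : ∀ y : Site d, y ∈ box (0 : Zd d) (4 * (K : ℤ)) → ∀ k, |y k| ≤ 4 * ((K + 1 : ℕ) : ℤ) := fun y hy k => by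
    have := (mem_box_zero_iff.mp hy) k; push_cast; linarith
  have hbig' : ∀ y : Site d, y ∈ box (0 : Zd d) (4 * (K : ℤ)) → ∀ (i k : Fin d), |(y + e i) k| ≤ 4 * ((K + 1 : ℕ) : ℤ) ∧ |(y - e i) k| ≤ 4 * ((K + 1 : ℕ) : ℤ) := by
    intro y hy i k
    have h := abs_add_unit_le (mem_box_zero_iff.mp hy) i k
    push_cast
    constructor <;> linarith [h.1, h.2]
  -- duality: it suffices to bound every real functional
  have hB0 : 0 ≤ 20 * Ch * (M₀ + ((K + 1 : ℕ) : ℝ) * (M₁ + M₂)) * Real.sqrt ((ρ₀ : ℝ) / ((K + 1 : ℕ) : ℝ)) := by positivity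
  refine NormedSpace.norm_le_dual_bound ℝ _ hB0 fun φ => ?_
  -- the scalar data
  set ν₀ : Fin d := ⟨0, hd⟩ with hν₀
  set u : Zd d → ℝ := fun y => φ (M y κ μ) with hu
  set G₀ : Zd d → ℝ := fun y => -((1 / (K : ℝ) ^ 2) * ∑ t ∈ Finset.Icc (-(4 * (K : ℤ))) (y ν₀), u (Function.update y ν₀ t)) with hG₀
  set G : Zd d → Fin d → ℝ := fun y ν =>
    φ (d₂ M y ν κ μ) + (if ν = κ then -φ (div₂ M (y + e κ) μ) else 0) + (if ν = μ then φ (div₂ M (y + e μ) κ) else 0)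
      + (if ν = ν₀ then G₀ y else 0) with hG
  -- (1) the Hodge identity, component `(κ, μ)`, as a flat identity on `M`
  have hHodge : ∀ z : Site d, ∑ i, ((M z κ μ - M (z + e i) κ μ) + (M z κ μ - M (z - e i) κ μ)) =
      (∑ a, (d₂ M (z - e a) a κ μ - d₂ M z a κ μ)) + (div₂ M (z + e κ) μ - div₂ M z μ) + (-div₂ M (z + e μ) κ + div₂ M z κ) := by
    intro z
    have h := congrFun (congrFun (congrFun (div₃_d₂_add_d₁_div₂ M) z) κ) μ
    simp only [Pi.add_apply] at h
    rw [show ∑ i, ((M z κ μ - M (z + e i) κ μ) + (M z κ μ - M (z - e i) κ μ)) = negLap₂ M z κ μ from rfl, ← h]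
    simp only [div₃, d₁]
    abel
  -- (2) the mass antiderivative telescopes: `G₀(y − e_{ν₀}) − G₀(y) = K⁻²·u(y)` inside the box
  have hG₀step : ∀ y : Zd d, y ∈ box (0 : Zd d) (4 * (K : ℤ)) → G₀ (y - unitVec ν₀) - G₀ y = (1 / (K : ℝ) ^ 2) * u y := by
    intro y hy
    have hyk : -(4 * (K : ℤ)) ≤ y ν₀ := by have := (mem_box_zero_iff.mp hy) ν₀; rw [abs_le] at this; exact this.1
    have hcoord : (y - unitVec ν₀) ν₀ = y ν₀ - 1 := by
      simp only [unitVec, Pi.sub_apply, Pi.single_eq_same]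
    have hupd : ∀ t, Function.update (y - unitVec ν₀) ν₀ t = Function.update y ν₀ t := by
      intro t; ext k
      by_cases hk : k = ν₀
      · subst hk; simp
      · rw [Function.update_of_ne hk, Function.update_of_ne hk]
        simp only [unitVec, Pi.sub_apply, Pi.single_eq_of_ne hk, sub_zero]
    have hself : Function.update y ν₀ (y ν₀) = y := Function.update_eq_self ν₀ y
    simp only [hG₀, hcoord, hupd]
    rw [Icc_eq_insert_Icc_sub_one hyk, Finset.sum_insert (not_mem_Icc_sub_one _ _), hself]
    ring
  -- (3) the equation `(−Δ + K⁻²)u = ∂*G` on the lit box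
  have hEq : ∀ y ∈ box (0 : Zd d) (4 * (K : ℤ)), lop (1 / (K : ℝ) ^ 2) u y = dvg G y := by
    intro y hy
    -- φ applied to the Hodge identity
    have h1 : ∑ i, ((u y - u (y + unitVec i)) + (u y - u (y - unitVec i))) =
        (∑ a, (φ (d₂ M (y - e a) a κ μ) - φ (d₂ M y a κ μ))) + (φ (div₂ M (y + e κ) μ) - φ (div₂ M y μ))
          + (-φ (div₂ M (y + e μ) κ) + φ (div₂ M y κ)) := by
      have := congrArg φ (hHodge y)
      simp only [map_sum, map_add, map_sub, map_neg] at this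
      simpa only [hu, e_eq_unitVec] using this
    -- the four pieces of `dvg G`
    have h2 : dvg G y = (∑ a, (φ (d₂ M (y - e a) a κ μ) - φ (d₂ M y a κ μ))) + (φ (div₂ M (y + e κ) μ) - φ (div₂ M y μ))
          + (-φ (div₂ M (y + e μ) κ) + φ (div₂ M y κ)) + (1 / (K : ℝ) ^ 2) * u y := by
      rw [dvg]
      simp only [hG]
      simp only [add_sub_add_comm, Finset.sum_add_distrib]
      have hA : ∑ ν, (φ (d₂ M (y - unitVec ν) ν κ μ) - φ (d₂ M y ν κ μ)) = ∑ a, (φ (d₂ M (y - e a) a κ μ) - φ (d₂ M y a κ μ)) := by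
        simp only [e_eq_unitVec]
      have hB : ∑ ν, ((if ν = κ then -φ (div₂ M (y - unitVec ν + e κ) μ) else 0) - (if ν = κ then -φ (div₂ M (y + e κ) μ) else 0)) =
          φ (div₂ M (y + e κ) μ) - φ (div₂ M y μ) := by
        rw [Finset.sum_eq_single κ (fun ν _ hν => by rw [if_neg hν, if_neg hν, sub_zero]) (fun h => absurd (Finset.mem_univ κ) h)]
        rw [if_pos rfl, if_pos rfl, e_eq_unitVec, sub_add_cancel]; ring
      have hC : ∑ ν, ((if ν = μ then φ (div₂ M (y - unitVec ν + e μ) κ) else 0) - (if ν = μ then φ (div₂ M (y + e μ) κ) else 0)) =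
          -φ (div₂ M (y + e μ) κ) + φ (div₂ M y κ) := by
        rw [Finset.sum_eq_single μ (fun ν _ hν => by rw [if_neg hν, if_neg hν, sub_zero]) (fun h => absurd (Finset.mem_univ μ) h)]
        rw [if_pos rfl, if_pos rfl, e_eq_unitVec, sub_add_cancel]; ring
      have hD : ∑ ν, ((if ν = ν₀ then G₀ (y - unitVec ν) else 0) - (if ν = ν₀ then G₀ y else 0)) = (1 / (K : ℝ) ^ 2) * u y := by
        rw [Finset.sum_eq_single ν₀ (fun ν _ hν => by rw [if_neg hν, if_neg hν, sub_zero]) (fun h => absurd (Finset.mem_univ ν₀) h)]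
        rw [if_pos rfl, if_pos rfl]
        exact hG₀step y hy
      rw [hA, hB, hC, hD]
    rw [h2, ← h1, lop]
    simp only [Finset.sum_add_distrib]
    have : ∀ i, 2 * u y - u (y + unitVec i) - u (y - unitVec i) = (u y - u (y + unitVec i)) + (u y - u (y - unitVec i)) := fun i => by ring
    simp only [this, Finset.sum_add_distrib]
  -- (4) the sup bound of `u` on the lit box
  have hφu : ∀ y ∈ box (0 : Zd d) (4 * (K : ℤ)), |u y| ≤ ‖φ‖ * M₀ := fun y hy => by
    rw [← Real.norm_eq_abs]
    exact (φ.le_opNorm _).trans (mul_le_mul_of_nonneg_left (hM y (hbig y hy) κ μ) (norm_nonneg _))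
  -- (5) the data bound `|G| ≤ m`
  set m : ℝ := ‖φ‖ * (M₂ + 2 * M₁ + 9 * M₀ / K) with hm
  have hφn : 0 ≤ ‖φ‖ := norm_nonneg _
  have hG₀b : ∀ y ∈ box (0 : Zd d) (4 * (K : ℤ)), |G₀ y| ≤ ‖φ‖ * (9 * M₀ / K) := by
    intro y hy
    have hyb := mem_box_zero_iff.mp hy
    have hcard : ((Finset.Icc (-(4 * (K : ℤ))) (y ν₀)).card : ℝ) ≤ 8 * K + 1 := by
      have h1 : (Finset.Icc (-(4 * (K : ℤ))) (y ν₀)).card ≤ (Finset.Icc (-(4 * (K : ℤ))) (4 * (K : ℤ))).card :=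
        Finset.card_le_card (Finset.Icc_subset_Icc le_rfl (by have := hyb ν₀; rw [abs_le] at this; exact this.2))
      have h2 : ((Finset.Icc (-(4 * (K : ℤ))) (4 * (K : ℤ))).card : ℤ) = 8 * K + 1 := by
        rw [Int.card_Icc]; omega
      have h3 : ((Finset.Icc (-(4 * (K : ℤ))) (y ν₀)).card : ℤ) ≤ 8 * K + 1 := by exact_mod_cast h2 ▸ (Int.ofNat_le.mpr h1)
      exact_mod_cast h3
    have hterm : ∀ t ∈ Finset.Icc (-(4 * (K : ℤ))) (y ν₀), |u (Function.update y ν₀ t)| ≤ ‖φ‖ * M₀ := by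
      intro t ht
      have htb : |t| ≤ 4 * (K : ℤ) := by
        rw [Finset.mem_Icc] at ht; have := hyb ν₀; rw [abs_le] at this ⊢; constructor <;> linarith [ht.1, ht.2, this.2]
      exact hφu _ (mem_box_zero_iff.mpr (abs_update_le hyb ν₀ htb))
    have hsum : |∑ t ∈ Finset.Icc (-(4 * (K : ℤ))) (y ν₀), u (Function.update y ν₀ t)| ≤ (8 * K + 1) * (‖φ‖ * M₀) := by
      refine (Finset.abs_sum_le_sum_abs _ _).trans ?_
      refine (Finset.sum_le_sum hterm).trans ?_
      rw [Finset.sum_const, nsmul_eq_mul]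
      exact mul_le_mul_of_nonneg_right hcard (by positivity)
    simp only [hG₀, abs_neg, abs_mul]
    rw [abs_of_pos (by positivity : (0 : ℝ) < 1 / (K : ℝ) ^ 2)]
    calc 1 / (K : ℝ) ^ 2 * |∑ t ∈ Finset.Icc (-(4 * (K : ℤ))) (y ν₀), u (Function.update y ν₀ t)|
        ≤ 1 / (K : ℝ) ^ 2 * ((8 * K + 1) * (‖φ‖ * M₀)) := mul_le_mul_of_nonneg_left hsum (by positivity)
      _ = ‖φ‖ * M₀ * ((8 * K + 1) / (K : ℝ) ^ 2) := by ring
      _ ≤ ‖φ‖ * M₀ * (9 / K) := by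
          refine mul_le_mul_of_nonneg_left ?_ (by positivity)
          rw [div_le_div_iff₀ (by positivity) hK0]
          nlinarith
      _ = ‖φ‖ * (9 * M₀ / K) := by ring
  have hGb : ∀ y ∈ box (0 : Zd d) (4 * (K : ℤ)), ∀ ν, |G y ν| ≤ m := by
    intro y hy ν
    have hy2 := hbig' y hy
    have t1 : |φ (d₂ M y ν κ μ)| ≤ ‖φ‖ * M₂ := by
      rw [← Real.norm_eq_abs]; exact (φ.le_opNorm _).trans (mul_le_mul_of_nonneg_left (hd₂ y (hbig y hy) ν κ μ) hφn)
    have t2 : |(if ν = κ then -φ (div₂ M (y + e κ) μ) else 0)| ≤ ‖φ‖ * M₁ := by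
      split_ifs
      · rw [abs_neg, ← Real.norm_eq_abs]; exact (φ.le_opNorm _).trans (mul_le_mul_of_nonneg_left (hdiv _ (fun k => (hy2 κ k).1) μ) hφn)
      · rw [abs_zero]; positivity
    have t3 : |(if ν = μ then φ (div₂ M (y + e μ) κ) else 0)| ≤ ‖φ‖ * M₁ := by
      split_ifs
      · rw [← Real.norm_eq_abs]; exact (φ.le_opNorm _).trans (mul_le_mul_of_nonneg_left (hdiv _ (fun k => (hy2 μ k).1) κ) hφn)
      · rw [abs_zero]; positivity
    have t4 : |(if ν = ν₀ then G₀ y else 0)| ≤ ‖φ‖ * (9 * M₀ / K) := by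
      split_ifs
      · exact hG₀b y hy
      · rw [abs_zero]; positivity
    calc |G y ν| ≤ |φ (d₂ M y ν κ μ)| + |(if ν = κ then -φ (div₂ M (y + e κ) μ) else 0)| + |(if ν = μ then φ (div₂ M (y + e μ) κ) else 0)|
          + |(if ν = ν₀ then G₀ y else 0)| := by
          simp only [hG]
          exact (abs_add_le _ _).trans (add_le_add ((abs_add_le _ _).trans (add_le_add (abs_add_le _ _) le_rfl)) le_rfl)
      _ ≤ ‖φ‖ * M₂ + ‖φ‖ * M₁ + ‖φ‖ * M₁ + ‖φ‖ * (9 * M₀ / K) := by linarith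
      _ = m := by rw [hm]; ring
  -- (6) the lit Hölder estimate at centre `0`
  have hz'box : (z' : Zd d) ∈ box (0 : Zd d) (ρ₀ : ℤ) := mem_box_zero_iff.mpr hz'
  have hres := hH K hK3 u G 0 (‖φ‖ * M₀) m (by positivity) (by positivity) hEq hφu hGb z' ρ₀ hρ₀ hρK hz'box
  -- (7) assemble: `K·m ≤ R(M₂ + 2M₁) + 9M₀`, `√(ρ₀∕K) ≤ 2√(ρ₀∕R)`
  have hu0 : u z' - u 0 = φ (M z' κ μ - M 0 κ μ) := by simp only [hu, map_sub]
  rw [Real.norm_eq_abs, ← hu0]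
  refine hres.trans ?_
  have hKm : (K : ℝ) * m ≤ ‖φ‖ * (((K : ℝ) + 1) * (M₁ + M₂) * 2 + 9 * M₀) := by
    rw [hm]
    have e1 : (K : ℝ) * (‖φ‖ * (M₂ + 2 * M₁ + 9 * M₀ / K)) = ‖φ‖ * (K * M₂ + 2 * K * M₁ + 9 * M₀) := by field_simp
    rw [e1]
    refine mul_le_mul_of_nonneg_left ?_ hφn
    nlinarith
  have hsqrt : Real.sqrt ((ρ₀ : ℝ) / K) ≤ 2 * Real.sqrt ((ρ₀ : ℝ) / ((K + 1 : ℕ) : ℝ)) := by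
    rw [hRK, show (2 : ℝ) = Real.sqrt 4 by rw [show (4:ℝ) = 2 ^ 2 by norm_num, Real.sqrt_sq (by norm_num)], ← Real.sqrt_mul (by norm_num)]
    refine Real.sqrt_le_sqrt ?_
    rw [div_le_iff₀ hK0, show 4 * ((ρ₀ : ℝ) / ((K : ℝ) + 1)) * K = (ρ₀ : ℝ) * (4 * K / (K + 1)) by ring]
    have : (1 : ℝ) ≤ 4 * K / (K + 1) := by rw [le_div_iff₀ (by positivity)]; linarith
    nlinarith [Nat.cast_nonneg (α := ℝ) ρ₀]
  have hS0 : 0 ≤ Real.sqrt ((ρ₀ : ℝ) / ((K + 1 : ℕ) : ℝ)) := Real.sqrt_nonneg _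
  calc Ch * (‖φ‖ * M₀ + K * m) * Real.sqrt ((ρ₀ : ℝ) / K)
      ≤ Ch * (‖φ‖ * M₀ + ‖φ‖ * (((K : ℝ) + 1) * (M₁ + M₂) * 2 + 9 * M₀)) * (2 * Real.sqrt ((ρ₀ : ℝ) / ((K + 1 : ℕ) : ℝ))) := by
        refine mul_le_mul (mul_le_mul_of_nonneg_left (by linarith) hCh0) hsqrt (Real.sqrt_nonneg _) ?_
        have : 0 ≤ ‖φ‖ * M₀ + ‖φ‖ * (((K : ℝ) + 1) * (M₁ + M₂) * 2 + 9 * M₀) := by positivity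
        positivity
    _ = (Ch * (10 * M₀ + 2 * (((K : ℝ) + 1) * (M₁ + M₂))) * 2 * Real.sqrt ((ρ₀ : ℝ) / ((K + 1 : ℕ) : ℝ))) * ‖φ‖ := by ring
    _ ≤ (20 * Ch * (M₀ + ((K + 1 : ℕ) : ℝ) * (M₁ + M₂)) * Real.sqrt ((ρ₀ : ℝ) / ((K + 1 : ℕ) : ℝ))) * ‖φ‖ := by
        refine mul_le_mul_of_nonneg_right ?_ hφn
        rw [hRK]
        have hX : 0 ≤ ((K : ℝ) + 1) * (M₁ + M₂) := by positivity
        have e1 : Ch * (10 * M₀ + 2 * (((K : ℝ) + 1) * (M₁ + M₂))) * 2 * Real.sqrt ((ρ₀ : ℝ) / ((K : ℝ) + 1))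
            = (Ch * Real.sqrt ((ρ₀ : ℝ) / ((K : ℝ) + 1))) * (20 * M₀ + 4 * (((K : ℝ) + 1) * (M₁ + M₂))) := by ring
        have e2 : 20 * Ch * (M₀ + ((K : ℝ) + 1) * (M₁ + M₂)) * Real.sqrt ((ρ₀ : ℝ) / ((K : ℝ) + 1))
            = (Ch * Real.sqrt ((ρ₀ : ℝ) / ((K : ℝ) + 1))) * (20 * M₀ + 20 * (((K : ℝ) + 1) * (M₁ + M₂))) := by ring
        rw [e1, e2]
        have hS0' : 0 ≤ Real.sqrt ((ρ₀ : ℝ) / ((K : ℝ) + 1)) := Real.sqrt_nonneg _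
        exact mul_le_mul_of_nonneg_left (by linarith) (mul_nonneg hCh0 hS0')

end Summit.QuantumFields.YangMills.Theorems.CurvGradFlat

end
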